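import Summits.NavierStokesRegularity.NavierStokesRegularity.Theorems.AxisTwistDoorAveragedConeLiouvilleHarnackDefs
import Summits.NavierStokesRegularity.NavierStokesRegularity.Theorems.AxisTwistDoorAveragedConeLiouvilleHarnackChain
import HarnessLib

/-!
# Route `AxisTwistDoor`, crux `AveragedConeLiouville` (stmt-NavierStokesRegularity-26889), line `lrt_shell` v6:
# the registered stub (5b-ii) `stub_axisHarnackChainA : AxisHarnackChainA` BY NAME

The pure-PDE Harnack chain of Lei–Ren–Tian (arXiv:2501.08976, §4 pp. 11–12) in the affine form registered by the
LEAD (`…HarnackDefs.AxisHarnackChainA`: `PositivityPropagationAffineC →` the one-scale improvement `Γ ≤ M − c` on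
`𝒬(9/20)` for every `Γ` with `AxisCirculationData`, a level `κ₀` met at all scales and `Γ ≤ M` on `𝒬(9/10)`), proved
in `…HarnackChain` (`HarnackChain.axisHarnackChain_of_affine`, on bricks `HarnackChainCore.chain_positivity`,
`HarnackChainData.*`, `AxisLift`, `RadialDrift`).  Width seat ns-in-wu-341 g2 under LEAD ns-atd-p1.
[cite: LeiRenTian2025, §4 (arXiv:2501.08976, pp. 11–12); NazarovUraltseva2011HarnackDivFree, Cor. 3.2]

WHAT THIS IS NOT: not a statement about Navier–Stokes regularity; the crux closes only CONDITIONALLY on the named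
Lei–Ren 2024 / Nazarov–Ural'tseva 2011 facts; `AveragedConeLiouville`, item 26889 and the summit remain OPEN.
-/

noncomputable section

-- the summit and its single sub-problem share the name (CONVENTIONS §1)
set_option linter.dupNamespace false

namespace Summit.NavierStokesRegularity.NavierStokesRegularity.Theorems.AveragedConeLiouville.HarnackChainA

open Summit.NavierStokesRegularity.NavierStokesRegularity.Theorems.AxisTwistDoorAveragedConeLiouvilleHarnackDefs

/-- **Registered stub `stub_axisHarnackChainA` of crux 26889 (line `lrt_shell`), exact signature `AxisHarnackChainA`.**
Proof: `HarnackChain.axisHarnackChain_of_affine`. [cite: LeiRenTian2025, §4 (arXiv:2501.08976, pp. 11–12)] -/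
theorem stub_axisHarnackChainA : AxisHarnackChainA :=
  HarnackChain.axisHarnackChain_of_affine

end Summit.NavierStokesRegularity.NavierStokesRegularity.Theorems.AveragedConeLiouville.HarnackChainA

end
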